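import Summits.ResolutionOfSingularities.ResolutionOfSingularities.Theorems.PurelyInseparableDim4ExceptionalLength
import Summits.ResolutionOfSingularities.ResolutionOfSingularities.Theorems.PurelyInseparableDim4NarrowApolarity
import Summits.ResolutionOfSingularities.ResolutionOfSingularities.Theorems.PurelyInseparableDim4IsolatedConeOneFree
import HarnessLib
import HarnessLib.Audit.Tags

/-!
# Purely inseparable dim 4 — the SUCCESSOR'S RIDGE against the exceptional hyperplane, and the ridge drop at a non-tangent move of order 2

Frame reading for the WIDE CORE of F4-I(p,p) (cell `res-dim4-pi`, CARD I-3-11 of seat idea-3, memo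
`iso6/WIDE-STRUCTURE.md` §2/§4), sequel of `PurelyInseparableDim4ExceptionalLength` ((U)/(NT), p662098).
One `Step0` edge `s ⟶ s⁺ = CentreBlowup.step p univ j b s` from a state of order exactly `p` with
`∇(in s.F) ≠ 0` (every cleaned state), at an equimultiple point `(j, b)`, `b_j = 0`; `A(·) =
additiveSubspace (initialForm ·)` is the ridge (`RidgeBudget.ebar = dim A`), `B_j = {w | w_j = 0}` the
exceptional hyperplane (`PointBlowup.boundarySubspace K {j}`).

* §1 **`mem_additiveSubspace_of_mem_additiveSubspace_step`** — `A(in s⁺.F) ∩ B_j ⊆ A(in s.F)`: the frame form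
  of [CJS 2020] Thm. 9.4 in the model (tree `CentreBlowup.mem_additiveSubspace_initialForm_of_apply_eq_zero`
  + `Directrix.additiveSubspace_initialForm_step`); idea-3's §2 lemma «successor ridge vs E» for every `ē`,
  not only the adapted frame.  Hence `finrank (A(in s⁺.F) ∩ B_j) + 1 ≤ ē(s)` (the blown-up direction
  `e_j + b ∈ A(in s.F)` is not in `B_j`), and at a VERY NEAR point (`ē(s⁺) = ē(s)`) the EQUALITY
  `A(in s⁺.F) ∩ B_j = A(in s.F) ∩ B_j` (transversality, tree `IsolatedBand.isTransversal_of_finrank_eq`).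
* §2 **`ebar_step_lt_of_X_mem_sup`** — if the exceptional coordinate is in the Hasse ideal to first order,
  `x_j ∈ J_p⁺(s⁺.F) + 𝔪₀²`, then `ē(s⁺) < ē(s)` (linear parts of `J_p⁺` kill the ridge:
  `NarrowApolarity.X_not_mem_sup`, so `A(in s⁺.F) ⊆ B_j`).
* §3 **`ebar_step_lt_of_aeval_eq_X_sq_mul`** — idea-3's (NT)(i): if some `g ∈ J_p⁺(s.F) + 𝔪₀^M`, `M ≥ 3`,
  pulls back to `σ^* g = x_j² · h` with `h(0) ≠ 0` («a non-tangent move of fat-point order 2»), then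
  `ē(s⁺) < ē(s)` — by (NT) `x_j ∈ J_p⁺(s⁺.F) + 𝔪₀^{M−1}` and §2; so a WIDE state (`ē = 2`) has a NARROW
  or ridge-free successor across such a move, and a narrow one a ridge-free successor.

OURS · counted 0 · elementary over the tree's vocabulary; nothing here proves `NoWideTrap`,
`NoIsolatedTrap 3 3`, or resolution of singularities in dimension `≥ 4` / characteristic `p`.
Supports stmt-ResolutionOfSingularities-16155 (helper).
bears_on: LADDER-RESOLUTION:D157-DOOR2 (res-dim4-pi · E2(3,3) wide core · I-3-11 §2 / (NT)(i)).
-/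

set_option linter.dupNamespace false -- mandated namespace of this single-conjunct summit

noncomputable section

namespace Summit.ResolutionOfSingularities.ResolutionOfSingularities.Theorems.PIDim4

namespace WideSuccessorRidge

open MvPolynomial Finset
open Literature.AlgebraicGeometry
open Literature.AlgebraicGeometry.Resolution
open Literature.AlgebraicGeometry.Resolution.Hauser2010
open Literature.AlgebraicGeometry.Resolution.HauserPerlega2019
open PointBlowup (direction gradSpan additiveSubspace boundarySubspace IsTransversal)

variable {K : Type} [Field K]

/-! ## 1. The successor's ridge inside the exceptional hyperplane -/

section Step

variable [DecidableEq K]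

/-- **[CJS 2020] Thm. 9.4, frame form.**  Along a `Step0` edge from a state of order `p` with `∇ ≠ 0`, at an
equimultiple point `(j, b)`: every ridge vector of the CLEANED successor tangent to the exceptional
hyperplane (`w'_j = 0`) is a ridge vector of `s` — `A(in s⁺.F) ∩ {w_j = 0} ⊆ A(in s.F)`.
[cite: CossartJannsenSaito2020, Thm. 9.4] -/
theorem mem_additiveSubspace_of_mem_additiveSubspace_step (p : ℕ) [Fact p.Prime] [CharP K p]
    {s : State K} (hord : ordZero s.F = p) (hgrad : gradSpan (initialForm s.F) ≠ ⊥) {j : Fin 4}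
    {b : Fin 4 → K} (hbj : b j = 0) (heq : CentreBlowup.IsEquimultiplePoint p Finset.univ j b s)
    {w' : Fin 4 → K}
    (hw' : w' ∈ additiveSubspace (initialForm (CentreBlowup.step p Finset.univ j b s).F))
    (hj : w' j = 0) : w' ∈ additiveSubspace (initialForm s.F) := by
  rw [Directrix.additiveSubspace_initialForm_step p hord hgrad hbj heq] at hw'
  exact CentreBlowup.mem_additiveSubspace_initialForm_of_apply_eq_zero p Finset.univ j (Finset.mem_univ j)
    b hbj (fun i hi => absurd (Finset.mem_univ i) hi) s hord
    (Directrix.le_ordAlong_univ_of_ordZero_eq hord) heq hj (fun i hi => absurd (Finset.mem_univ i) hi) hw'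

/-- The same, for subspaces: `A(in s⁺.F) ⊓ B_j ≤ A(in s.F) ⊓ B_j`. [cite: CossartJannsenSaito2020, Thm. 9.4] -/
theorem additiveSubspace_step_inf_le (p : ℕ) [Fact p.Prime] [CharP K p] {s : State K}
    (hord : ordZero s.F = p) (hgrad : gradSpan (initialForm s.F) ≠ ⊥) {j : Fin 4} {b : Fin 4 → K}
    (hbj : b j = 0) (heq : CentreBlowup.IsEquimultiplePoint p Finset.univ j b s) :
    additiveSubspace (initialForm (CentreBlowup.step p Finset.univ j b s).F) ⊓ boundarySubspace K {j} ≤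
      additiveSubspace (initialForm s.F) ⊓ boundarySubspace K {j} := by
  intro w' hw'
  obtain ⟨hA, hB⟩ := Submodule.mem_inf.mp hw'
  have hj : w' j = 0 := PointBlowup.mem_boundarySubspace.mp hB j (Finset.mem_singleton_self j)
  exact Submodule.mem_inf.mpr
    ⟨mem_additiveSubspace_of_mem_additiveSubspace_step p hord hgrad hbj heq hA hj, hB⟩

end Step

/-- The direction `e_j + b` of a chart point is not tangent to the exceptional hyperplane `{w_j = 0}`.
[folklore] -/
theorem direction_not_mem_boundarySubspace (j : Fin 4) (b : Fin 4 → K) :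
    direction j b ∉ boundarySubspace K ({j} : Finset (Fin 4)) := by
  intro h
  have h1 := PointBlowup.mem_boundarySubspace.mp h j (Finset.mem_singleton_self j)
  rw [direction, Function.update_self] at h1
  exact one_ne_zero h1

/-- At an equimultiple point the ridge is NOT inside the exceptional hyperplane, so
`dim (A(in s.F) ∩ B_j) + 1 ≤ ē(s)`. [cite: CossartJannsenSaito2020, Thm. 3.14] -/
theorem finrank_inf_boundary_add_one_le (p : ℕ) [Fact p.Prime] [CharP K p] {s : State K}
    (hord : ordZero s.F = p) {j : Fin 4} {b : Fin 4 → K} (hbj : b j = 0)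
    (heq : CentreBlowup.IsEquimultiplePoint p Finset.univ j b s) :
    Module.finrank K ↥(additiveSubspace (initialForm s.F) ⊓ boundarySubspace K {j}) + 1 ≤
      RidgeBudget.ebar s.F := by
  rw [RidgeBudget.ebar]
  have hlt : additiveSubspace (initialForm s.F) ⊓ boundarySubspace K {j} <
      additiveSubspace (initialForm s.F) :=
    lt_of_le_of_ne inf_le_left fun h =>
      direction_not_mem_boundarySubspace j b
        (Submodule.mem_inf.mp (h.symm ▸ Directrix.direction_mem_additiveSubspace p hord hbj heq)).2
  exact Submodule.finrank_lt_finrank_of_lt hlt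

section Step

variable [DecidableEq K]

/-- **The successor's ridge meets the exceptional hyperplane in dimension `≤ ē(s) − 1`.**
[cite: CossartJannsenSaito2020, Thm. 9.4 and Thm. 3.14] -/
theorem finrank_additiveSubspace_step_inf_add_one_le (p : ℕ) [Fact p.Prime] [CharP K p]
    {s : State K} (hord : ordZero s.F = p) (hgrad : gradSpan (initialForm s.F) ≠ ⊥) {j : Fin 4}
    {b : Fin 4 → K} (hbj : b j = 0) (heq : CentreBlowup.IsEquimultiplePoint p Finset.univ j b s) :
    Module.finrank K ↥(additiveSubspace (initialForm (CentreBlowup.step p Finset.univ j b s).F) ⊓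
        boundarySubspace K {j}) + 1 ≤ RidgeBudget.ebar s.F :=
  le_trans (Nat.add_le_add_right (Submodule.finrank_mono (additiveSubspace_step_inf_le p hord hgrad hbj heq)) 1)
    (finrank_inf_boundary_add_one_le p hord hbj heq)

/-- **Very near ⟹ the exceptional part of the ridge is transported identically**: if `ē(s⁺) = ē(s)`
then `A(in s⁺.F) ∩ B_j = A(in s.F) ∩ B_j` (containment by Thm. 9.4; both sides have dimension `ē − 1`:
the left by transversality at a very near point, [CJS 2020] Thm. 9.3, tree
`IsolatedBand.isTransversal_of_finrank_eq`; the right by §1). [cite: CossartJannsenSaito2020, Thm. 9.3 and Thm. 9.4] -/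
theorem additiveSubspace_step_inf_eq_of_finrank_eq (p : ℕ) [Fact p.Prime] [CharP K p]
    {s : State K} (hord : ordZero s.F = p) (hgrad : gradSpan (initialForm s.F) ≠ ⊥) {j : Fin 4}
    {b : Fin 4 → K} (hbj : b j = 0) (heq : CentreBlowup.IsEquimultiplePoint p Finset.univ j b s)
    (he : Module.finrank K (additiveSubspace (initialForm (CentreBlowup.step p Finset.univ j b s).F)) =
      Module.finrank K (additiveSubspace (initialForm s.F))) :
    additiveSubspace (initialForm (CentreBlowup.step p Finset.univ j b s).F) ⊓ boundarySubspace K {j} =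
      additiveSubspace (initialForm s.F) ⊓ boundarySubspace K {j} := by
  have hT := IsolatedBand.isTransversal_of_finrank_eq p hord hgrad hbj heq he
  unfold PointBlowup.IsTransversal at hT
  rw [Finset.card_singleton] at hT
  refine Submodule.eq_of_le_of_finrank_le (additiveSubspace_step_inf_le p hord hgrad hbj heq) ?_
  have h2 := finrank_inf_boundary_add_one_le p hord hbj heq
  rw [RidgeBudget.ebar] at h2
  omega

end Step

/-! ## 2. The exceptional coordinate in the Hasse ideal to first order ⟹ the ridge drops -/

/-- If `x_j ∈ J_p⁺(F) + 𝔪₀²` at a point of order exactly `p`, every ridge vector has `w_j = 0` (linear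
parts of `J_p⁺ + 𝔪₀²` kill the ridge, `NarrowApolarity.X_not_mem_sup`). [folklore] -/
theorem apply_eq_zero_of_X_mem_sup {p : ℕ} {F : MvPolynomial (Fin 4) K} (hord : ordZero F = p)
    {j : Fin 4} (hX : (X j : MvPolynomial (Fin 4) K) ∈ singLocusIdeal p F ⊔ originIdeal K ^ 2)
    {w : Fin 4 → K} (hw : w ∈ additiveSubspace (initialForm F)) : w j = 0 := by
  by_contra hwj
  exact NarrowApolarity.X_not_mem_sup hord hw hwj hX

/-- Then the whole ridge lies in the exceptional hyperplane: `A(in F) ≤ B_j`. [folklore] -/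
theorem additiveSubspace_le_boundary_of_X_mem_sup {p : ℕ} {F : MvPolynomial (Fin 4) K}
    (hord : ordZero F = p) {j : Fin 4}
    (hX : (X j : MvPolynomial (Fin 4) K) ∈ singLocusIdeal p F ⊔ originIdeal K ^ 2) :
    additiveSubspace (initialForm F) ≤ boundarySubspace K {j} := fun w hw =>
  PointBlowup.mem_boundarySubspace.mpr fun i hi => by
    rw [Finset.mem_singleton] at hi
    subst hi
    exact apply_eq_zero_of_X_mem_sup hord hX hw

/-- **The ridge drops when the exceptional coordinate is in the Hasse ideal to first order.**  Along a
`Step0` edge (order `p`, `∇ ≠ 0`, equimultiple `(j,b)`, `b_j = 0`): `x_j ∈ J_p⁺(s⁺.F) + 𝔪₀² ⟹ ē(s⁺) < ē(s)`.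
[cite: CossartJannsenSaito2020, Thm. 9.4] -/
theorem ebar_step_lt_of_X_mem_sup [DecidableEq K] (p : ℕ) [Fact p.Prime] [CharP K p] {s : State K}
    (hord : ordZero s.F = p) (hgrad : gradSpan (initialForm s.F) ≠ ⊥) {j : Fin 4} {b : Fin 4 → K}
    (hbj : b j = 0) (heq : CentreBlowup.IsEquimultiplePoint p Finset.univ j b s)
    (hX : (X j : MvPolynomial (Fin 4) K) ∈
      singLocusIdeal p (CentreBlowup.step p Finset.univ j b s).F ⊔ originIdeal K ^ 2) :
    RidgeBudget.ebar (CentreBlowup.step p Finset.univ j b s).F < RidgeBudget.ebar s.F := by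
  have hord' : ordZero (CentreBlowup.step p Finset.univ j b s).F = p :=
    Directrix.ordZero_step_eq p hord hgrad hbj heq
  have hle : additiveSubspace (initialForm (CentreBlowup.step p Finset.univ j b s).F) ≤
      additiveSubspace (initialForm (CentreBlowup.step p Finset.univ j b s).F) ⊓ boundarySubspace K {j} :=
    le_inf le_rfl (additiveSubspace_le_boundary_of_X_mem_sup hord' hX)
  have h1 := Submodule.finrank_mono hle
  have h2 := finrank_additiveSubspace_step_inf_add_one_le p hord hgrad hbj heq
  rw [RidgeBudget.ebar]
  omega

/-! ## 3. (NT)(i): a non-tangent move of fat-point order 2 drops the ridge -/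

/-- **(NT)(i) — a non-tangent move of order `2` drops `ē`.**  Along a `Step0` edge (order `p`, `∇ ≠ 0`,
equimultiple `(j,b)`, `b_j = 0`): if some `g ∈ J_p⁺(s.F) + 𝔪₀^M` with `M ≥ 3` pulls back under the chart
substitution to `x_j² · h` with `h(0) ≠ 0`, then `ē(s⁺) < ē(s)` ((NT): `x_j ∈ J_p⁺(s⁺.F) + 𝔪₀^{M−1}
⊆ J_p⁺(s⁺.F) + 𝔪₀²`; then §2).  In particular a WIDE state (`ē = 2`) does not have a wide successor across
such a move (CARD I-3-11 (NT)(i)). [cite: Kollar2007, Theorem 3.76 (char p, m = p)]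
[cite: CossartJannsenSaito2020, Thm. 9.4] -/
theorem ebar_step_lt_of_aeval_eq_X_sq_mul [DecidableEq K] (p : ℕ) [Fact p.Prime] [CharP K p]
    {s : State K} (hord : ordZero s.F = p) (hgrad : gradSpan (initialForm s.F) ≠ ⊥) {j : Fin 4}
    {b : Fin 4 → K} (hbj : b j = 0) (heq : CentreBlowup.IsEquimultiplePoint p Finset.univ j b s)
    {g h : MvPolynomial (Fin 4) K} {M : ℕ} (hM : 3 ≤ M)
    (hg : g ∈ singLocusIdeal p s.F ⊔ originIdeal K ^ M)
    (hσ : aeval (fun i => if i = j then (X j : MvPolynomial (Fin 4) K) else X j * (X i + C (b i))) g =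
      X j ^ 2 * h)
    (hh : constantCoeff h ≠ 0) :
    RidgeBudget.ebar (CentreBlowup.step p Finset.univ j b s).F < RidgeBudget.ebar s.F := by
  have h1 := ExceptionalLength.X_pow_pred_mem_of_aeval_eq_mul_unit p s j b hbj
    (Directrix.le_ordAlong_univ_of_ordZero_eq hord) (by norm_num : 1 ≤ 2) hg hσ hh
  rw [show 2 - 1 = 1 from rfl, pow_one] at h1
  have hpow : originIdeal K ^ (M - 1) ≤ originIdeal K ^ 2 := Ideal.pow_le_pow_right (by omega)
  exact ebar_step_lt_of_X_mem_sup p hord hgrad hbj heq (sup_le_sup_left hpow _ h1)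

/-- **From a wide state, a non-tangent move of order `2` lands on a narrow or ridge-free state**
(`ē(s⁺) ≤ 1`). [cite: CossartJannsenSaito2020, Thm. 9.4] -/
theorem ebar_step_le_one_of_aeval_eq_X_sq_mul [DecidableEq K] (p : ℕ) [Fact p.Prime] [CharP K p]
    {s : State K} (hord : ordZero s.F = p) (he : RidgeBudget.ebar s.F = 2) {j : Fin 4}
    {b : Fin 4 → K} (hbj : b j = 0) (heq : CentreBlowup.IsEquimultiplePoint p Finset.univ j b s)
    {g h : MvPolynomial (Fin 4) K} {M : ℕ} (hM : 3 ≤ M)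
    (hg : g ∈ singLocusIdeal p s.F ⊔ originIdeal K ^ M)
    (hσ : aeval (fun i => if i = j then (X j : MvPolynomial (Fin 4) K) else X j * (X i + C (b i))) g =
      X j ^ 2 * h)
    (hh : constantCoeff h ≠ 0) :
    RidgeBudget.ebar (CentreBlowup.step p Finset.univ j b s).F ≤ 1 := by
  have hgrad : gradSpan (initialForm s.F) ≠ ⊥ :=
    (Directrix.gradSpan_ne_bot_iff_finrank_additiveSubspace_le _).mpr (by
      rw [RidgeBudget.ebar] at he; omega)
  have h := ebar_step_lt_of_aeval_eq_X_sq_mul p hord hgrad hbj heq hM hg hσ hh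
  omega

end WideSuccessorRidge

end Summit.ResolutionOfSingularities.ResolutionOfSingularities.Theorems.PIDim4

end
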